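import Summits.AtomisticToContinuum.Crystallization.Theorems.ChartedZeroExcessLayeredLatticeLiouvilleYB

/-!
(SPLIT FOR THE 400-LINE CAP by the landing lane, hand-2 g31: this file = part 1 of 3; sequels `…ChartedZeroExcessLayeredLatticeLiouvilleYCB`, `…ChartedZeroExcessLayeredLatticeLiouvilleYC` import it in a chain; same namespace, all FQNs unchanged.)
# Charted zero-excess layered lattice Liouville — part YC «WarmCoolCut»: the AMPLITUDE × ORIENTATION dichotomy beneath the single-tolerance
# leaf [W_Ψᵇ₁] — `[W_Ψᵇ₁|₇] ⟸ [ΨCoolᵇ] ∧ [CoolLockedᵇ]` (PROVED), the kinematic factorisation `[ΨCoolᵇ] ⟸ [NoWarmᵇ] ∧ [ΨRealᵇ]` (PROVED),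
# the SPARSE (site-level special/generic) cut `(R_Wᵇ) ⟸ [Tᵇ] ∧ [ISᵇ] ⟸ [Tᵇ] ∧ [WSᵇ] ∧ [DSᵇ]` (PROVED), and the columns `_16XH22B`, `_16XH22B₂`, `_16XH22Bˢ`

Docket `stmt-AtomisticToContinuum-26636` (N = `ChartedPlanarOrder.ChartedZeroExcessLayered`), cell decomp-a2c, seat lens-2 g61 (lens «structural dichotomy
(special vs generic)»; CRITIC-LEDGER rows 1160 (iii)/(iv), 1162: LOAD MAP of [W_Ψᵇ₁] at the pair — (α) Ψ-realisation, (β) orientation locking, (γ) misfit gain).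

THE LOAD MAP, TYPED.  The residual of record [W_Ψᵇ₁] `CoherentWindowPsiBPG₁ (1/100) (1/200) tameRadius …` (part YB) asks, at EVERY site of the tame window,
for a rotation that is BOTH `1/100`-accurate against `Ψ` (misfit) AND `1/200`-close to the identity (tilt).  Two currencies separate the two demands with
NO new definition: «Ψ-COOL at `ϑ₁`» := `IsCoherentBy ϑ₁ 2 S Ψ K` (the tilt clause `tilt U ≤ 2` is VACUOUS, `tilt_le_two`: a free PROPER rotation realises `Ψ`
on the star within `ϑ₁`) and «LOCKED» := the same with tilt `≤ ω₁`.  Site classes by misfit amplitude: HOT (not `tameRadius`-tame; excluded by [Tᵇ] =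
[I_D] ∧ [T_bᵇ]) · WARM (tame but not Ψ-cool at `ϑ₁`) · COOL (Ψ-cool) = LOCKED ⊔ DRIFTING.  [W_Ψᵇ₁] = «no warm site» ∧ «no drifting site».

* YC-1 KINEMATICS (PROVED): `tilt_le_two`; `isCoherentBy_two_of_free` (free proper rotations witness Ψ-coolness); `isCoherentBy_zero_of_dom` (a site whose
  bond distortions are `≤ ϑ₁` — e.g. registration profile `τ x ≤ ϑ₁`, part Q domination clause — is `(ϑ₁, 0)`-coherent with `U := 1`: COHERENCE IS FREE
  WHERE THE PROFILE IS SMALL, so by Chebyshev the incoherent sites of `win R` number `≤ Στ²/ϑ₁² ≤ Cg·(1+4/R)·η·nK/ϑ₁²` — (R_Wᵇ) at `εw ≍ C(δ)·Cg/ϑ₁²` is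
  kinematic; ALL content of the leaves below is the `o(1)` in `εw`); dictionary `IsCoherentBy.isTameOn_of_le`.
* YC-2 THE SUP-NORM CUT (layer 1).  [ΨCoolᵇ] `PsiCoolWindowBPG ϑ₁ ϑ` := B → tame `ϑ` on `win 9R` → Ψ-cool `ϑ₁` on `win 8R` (THE MISFIT GAIN (γ)+(α):
  amplitude only, tilt-blind); [CoolLockedᵇ] `CoolLockedWindowBPG ϑ₁ ω₁ ϑ` := B → tame `ϑ` on `win 9R` → Ψ-cool `ϑ₁` on `win 8R` → `(ϑ₁, ω₁)`-coherent on
  `win 7R` (ORIENTATION LOCKING (β) INSIDE THE COOL BASIN: perturbative ε-regularity); the target at conclusion radius `c`, `CoherentWindowPsiBPGAt c ϑ₁ ω₁ ϑ`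
  (`At 9 ↔ [W_Ψᵇ₁]` by `Iff.rfl`, antitone in `c`); GLUE `coherentWindowPsiBPGAt_seven_of_cool_locked` (PROVED); WEAKER certificates
  `psiCoolWindowBPG_of_coherentAt`, `coolLockedWindowBPG_of_coherentAt` (both pieces are implied by the residual of record, PROVED).
* YC-3 THE KINEMATIC FACTORISATION of the misfit gain (layer 2): [NoWarmᵇ] `NoWarmWindowBPG ϑ ϑc` := B → tame `ϑ` on `win 9R` → tame `ϑc` on `win 8R`
  ((γ) PURE: `S`-intrinsic misfit gain `1/20 → ϑc`, `U, g` free — the NON-PERTURBATIVE warm band) and [ΨRealᵇ] `PsiRealisationBP ϑc ϑ₁ ϑ` := B → tame `ϑ` on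
  `win 9R` → tame `ϑc` on `win 8R` → Ψ-cool `ϑ₁` on `win 8R` ((α): the free registration `g` of a `ϑc`-tame star and the bond isomorphism `Ψ` differ on
  the star by a congruence of two contact-isomorphic chart patches — chart-side PATCH RIGIDITY WITH ROTATIONS, loss `ϑ₁ − ϑc ≥ osc_H`; plus ORIENTATION
  PROPAGATION: `det = +1` is locally constant along bonds because `‖SO(3) − O⁻(3)‖ = 2`, and proper at any site with `τ x < 1`; NO `S`-side energy — KINEMATIC,
  not bookkeeping: two lemmas are owed); GLUE `psiCoolWindowBPG_of_noWarm_real` (PROVED); certificates `noWarmWindowBPG_of_psiCool` ([ΨCoolᵇ](ϑc) ⇒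
  [NoWarmᵇ](ϑ, ϑc)), `psiRealisationBP_of_psiCool` (PROVED).
* YC-4 SEAM + COLUMNS: `wildFractionBPG_of_tame_coherentAt` (`1 ≤ c`, side condition `4ω₁ + ϑ₁ < tameRadius`), ★★★ `gap_and_pert_1_50_of_certs_16XH22B`
  (= `_16XH21B₁` with [W_Ψᵇ₁] replaced by [ΨCoolᵇ](1/100) ∧ [CoolLockedᵇ](1/100, 1/200)) and `_16XH22B₂` (layer 2 at `ϑc = 1/200`: [NoWarmᵇ](1/20 → 1/200) ∧
  [ΨRealᵇ](1/200 → 1/100) ∧ [CoolLockedᵇ]); recovery `_16XH22B ⟸ _16XH21B₁'s trio` is the pair of WEAKER certificates.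
* YC-5 THE SPARSE CUT (lens-2 proper: SPECIAL = coherent sites, GENERIC = incoherent sites, and the generic class is SPARSE, not empty).  `incoherentCount`,
  `driftCount` (classical indicators summed over the window); `wildMass_le_incoherentCount` (PROVED: a `ϑ`-wild bond sits at an incoherent site when
  `4ω₁ + ϑ₁ < ϑ`, each site carries `≤ (8/δ+1)³` bonds of squared distortion `≤ 144`); leaves [ISᵇ] `IncoherenceSparseBPG ϑ₁ ω₁ ϑ` (incoherent count
  `≤ εw·η·nK(win R)`), [WSᵇ] `WarmSparseBPG ϑ₁ ϑ` (warm count), [DSᵇ] `DriftSparseBPG ϑ₁ ω₁ ϑ` (cool-but-drifting count); `incoherentCount_le_warm_add_drift`,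
  GLUE `incoherenceSparseBPG_of_warm_drift`, SEAM `wildFractionBPG_of_tame_sparse` (PROVED), column `_16XH22Bˢ`; every sparse leaf is implied by the
  corresponding sup leaf (PROVED: `…_of_coherentAt`, `…_of_psiCool`).  THE SPARSE LEAVES ARE THE COUNT SHADOW OF THE TREE'S `L³` CUT (K) ∧ (Mᵇ) (parts
  TR/UI, column `_16XH19B_tol`) for the GIVEN bond isomorphism (`incoherentCount_le_of_tiltStrainData`, YC-6, PROVED: `#incoherent ≤ Σσ³/ϑ₁³ + Σtilt³/ω₁³`
  for ANY tilt–strain data of `Ψ`): [WSᵇ] inherits (M)'s mechanism (HIGHER INTEGRABILITY of the bond-isomorphic registration strain — Caccioppoli modulo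
  rigid motions + Gehring) and [DSᵇ] inherits (K)'s (Friesecke–James–Müller rigidity in `L³`).  So the file places the docket of record (sup-norm trio) and
  the off-docket `L³` pair on ONE scale: trio ⇒ [W_Ψᵇ₁|c] ⇒ [ISᵇ] ⇐ (K) ∧ (M)-for-`Ψ` (Chebyshev), every arrow kernel-checked at window level.
  DEAD END (recorded, not typed): the naive ENERGY route to [WSᵇ] («tame-class coercivity `E_S(win) − E_H(Ψ win) ≥ c·Σm²` ⊕ GSC quadratic excess `≤ C·R²` ⇒
  `#warm = O(R²)`») is BARRED — the first variation of a window energy between two equilibria is BOUNDARY WORK `Σ_{∂win} F^{ext}·(u − rigid)`, of size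
  `≲ ρ^{3/2}·(Σ_{win} m²)^{1/2}` after rigidity + trace, which beats the quadratic gain `c·Σm²` whenever `⨍m² ≲ (C/c)²`, i.e. at every small strain (and the
  word floor of part UC bars the sitewise version); only COMPACTLY SUPPORTED tests of the GSC inequality avoid it — which is (M)'s Caccioppoli route.
* YC-6 THE KINEMATIC HALF QUANTIFIED (PROVED): `incoherentCount_le_of_dom_sq` (Chebyshev: sites with profile `> ϑ₁` are the only `(ϑ₁, 0)`-incoherent ones)
  and `incoherentCount_le_of_tiltStrainData` (the cubic Chebyshev against tilt–strain data: the shadow of (K) ∧ (M)).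

Literals of the columns: `ϑ = tameRadius = 1/20` (hot), `ϑc = 1/200` (cool, free `U, g`), `ϑ₁ = 1/100` (Ψ-misfit), `ω₁ = 1/200` (tilt); `4/200 + 1/100 < 1/20`.
No proof holes, no new axiom, no instances, no notations, no option overrides; classical indicators via `open scoped Classical` (tree precedent).
-/

noncomputable section

open scoped BigOperators Classical
open MeasureTheory Set Metric Filter Topology
open Summit.AtomisticToContinuum.Crystallization.Theorems.ChartedPlanarOrderRigidityDoor (E3 atomsIn VisibleGap PertRegime)
open Summit.AtomisticToContinuum.Crystallization.Theorems.ChartedPlanarOrderDensityDichotomy (μS IsSep nK nK_nonneg)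
open Summit.AtomisticToContinuum.Crystallization.Theorems.ChartedPlanarOrderCleanScaleP (IsCleanP IsDoorSetP)
open Summit.AtomisticToContinuum.Crystallization.Theorems.ChartedPlanarOrderMesoCut (LayeredHom EnvClose)
open Summit.AtomisticToContinuum.Crystallization.Theorems.ChartedPlanarOrderDoorLayered (atomsIn_subset sq_le_finsum_mem PeriodicBulkGapDoor)
open Summit.AtomisticToContinuum.Crystallization.Theorems.ChartedPlanarOrderDoorLayeredOsc (IsTwoShellAffineGood)

namespace Summit.AtomisticToContinuum.Crystallization.Theorems.ChartedZeroExcessLayeredLatticeLiouville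

/-! ### YC-1  Kinematics: Ψ-coolness, free coherence where the profile is small, dictionary -/

/-- the tilt of any linear isometry is at most `2` (`‖U − 1‖ ≤ ‖U‖ + ‖1‖`): the tilt clause of `IsCoherentBy ϑ₁ 2` is VACUOUS, which is how this file
spells «Ψ-cool at `ϑ₁`» (a free PROPER rotation realises `Ψ` on the star within `ϑ₁`). [this file, g61] -/
theorem tilt_le_two (U : E3 ≃ₗᵢ[ℝ] E3) : tilt U ≤ 2 := by
  unfold tilt
  refine ContinuousLinearMap.opNorm_le_bound _ (by norm_num) fun v => ?_
  have h1 : ((U.toContinuousLinearEquiv : E3 →L[ℝ] E3) - ContinuousLinearMap.id ℝ E3) v = U v - v := by simp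
  rw [h1]
  calc ‖U v - v‖ ≤ ‖U v‖ + ‖v‖ := norm_sub_le _ _
    _ = 2 * ‖v‖ := by rw [LinearIsometryEquiv.norm_map]; ring

/-- **free proper rotations witness Ψ-coolness**: if every star centred in `K` is realised by `Ψ` within `ϑ₁` after SOME rotation of determinant `1`, then
`IsCoherentBy ϑ₁ 2 S Ψ K`. [this file, g61] -/
theorem isCoherentBy_two_of_free {ϑ₁ : ℝ} {S K : Set E3} {Ψ : E3 → E3}
    (h : ∀ x ∈ K, ∃ U : E3 ≃ₗᵢ[ℝ] E3, LinearMap.det (U.toLinearEquiv : E3 →ₗ[ℝ] E3) = 1 ∧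
      ∀ p ∈ S, dist p x ≤ 4 → dist (U (p - x)) (Ψ p - Ψ x) ≤ ϑ₁) : IsCoherentBy ϑ₁ 2 S Ψ K := fun x hx => by
  obtain ⟨U, hU, hb⟩ := h x hx
  exact ⟨U, hU, tilt_le_two U, hb⟩

/-- ★ **coherence is FREE where the bond distortions are small**: if every `4`-bond at the sites of `K` is distorted by at most `ϑ₁` under `Ψ` — e.g.
`τ x ≤ ϑ₁` for the registration profile `τ` (domination clause of part Q `IsRegistered`) — then `K` is `(ϑ₁, 0)`-coherent by `Ψ` with `U := 1`.  The sites
that [W_Ψᵇ₁] has to work for are only those with profile `> ϑ₁`, which Chebyshev makes `≤ Στ²/ϑ₁²`-few (YC-6). [this file, g61] -/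
theorem isCoherentBy_zero_of_dom {ϑ₁ : ℝ} {S K : Set E3} {Ψ : E3 → E3}
    (h : ∀ x ∈ K, ∀ p ∈ S, dist p x ≤ 4 → dist (p - x) (Ψ p - Ψ x) ≤ ϑ₁) : IsCoherentBy ϑ₁ 0 S Ψ K := fun x hx =>
  ⟨LinearIsometryEquiv.refl ℝ E3, det_refl_E3_eq_one, tilt_refl.le, fun p hp hpx => h x hx p hp hpx⟩

/-- DICTIONARY: Ψ-coherence (in particular Ψ-coolness) at misfit `ϑ₁ ≤ ϑ` by a map `Ψ : S → H` is `ϑ`-tameness (`U :=` the rotation, `g := Ψ`). [this file, g61] -/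
theorem IsCoherentBy.isTameOn_of_le {ϑ₁ ω₁ ϑ : ℝ} {S H K : Set E3} {Ψ : E3 → E3} (h : IsCoherentBy ϑ₁ ω₁ S Ψ K) (hΨ : MapsTo Ψ S H)
    (hϑ : ϑ₁ ≤ ϑ) : IsTameOn ϑ S H K :=
  ((h.isCoherentOn hΨ).isTameOn).mono hϑ Subset.rfl

/-- windows are nested: `win (c'·R) ⊆ win (c·R)` for `c' ≤ c` and `0 ≤ R`. [this file, g61] -/
theorem atomsIn_mono_mul {S : Set E3} {c c' R : ℝ} (hc : c' ≤ c) (hR : 0 ≤ R) :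
    atomsIn (μS S) 0 (c' * R) ⊆ atomsIn (μS S) 0 (c * R) :=
  atomsIn_mono_radius (mul_le_mul_of_nonneg_right hc hR)

/-! ### YC-2  The sup-norm cut: [W_Ψᵇ₁|c] ⟸ [ΨCoolᵇ] ∧ [CoolLockedᵇ] -/

/-- ★★ **[W_Ψᵇ₁|c] «CoherentWindowPsiBPGAt c ϑ₁ ω₁ ϑ aHi Λ θ s»** — the single-tolerance leaf [W_Ψᵇ₁] of part YB with the CONCLUSION RADIUS a parameter:
tame `ϑ` on `win 9R` ⇒ `(ϑ₁, ω₁)`-coherent by `Ψ` on `win (c·R)`.  `At 9` IS [W_Ψᵇ₁] (`coherentWindowPsiBPGAt_nine_iff`, `Iff.rfl`); antitone in `c`; every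
`c ≥ 1` cuts (R_Wᵇ) under the side condition (`wildFractionBPG_of_tame_coherentAt`: the wild mass lives on `win R`).  ε-REGULARITY-type · GSC-priced ·
UNDECIDED · WEAKER than [W_Ψᵇ₁] for `c ≤ 9` (PROVED).  Why it might fail / Sources: as [W_Ψᵇ₁] (part YB). [this file, g61] -/
def CoherentWindowPsiBPGAt (c ϑ₁ ω₁ ϑ aHi Λ θ s : ℝ) : Prop :=
  ∀ δ : ℝ, 0 < δ → ∀ a : ℝ, 0 < a → ∀ Cg : ℝ, 1 ≤ Cg → ∀ K₀ : ℝ, 0 < K₀ → ∃ η₁ : ℝ, 0 < η₁ ∧ ∃ R₁ : ℝ, 0 < R₁ ∧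
    ∀ S : Set E3, IsDoorSetPG aHi δ S → (∀ q ∈ S, IsTwoShellAffineGood θ S q) →
      ∀ η : ℝ, 0 < η → η ≤ η₁ → ∀ R : ℝ, R₁ ≤ R →
        ∀ (L : E3 ≃L[ℝ] E3) (w : ℤ → E3), IsEquilChart a s Λ L w →
          ∀ Ψ : E3 → E3, IsGlobalReg Cg η R S (LayeredHom (L : E3 →L[ℝ] E3) w) Ψ → IsBondIso S Ψ →
            K₀ ≤ η * nK (atomsIn (μS S) 0 R) →
              IsTameOn ϑ S (LayeredHom (L : E3 →L[ℝ] E3) w) (atomsIn (μS S) 0 (9 * R)) →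
              IsCoherentBy ϑ₁ ω₁ S Ψ (atomsIn (μS S) 0 (c * R))

/-- `At 9` is [W_Ψᵇ₁] verbatim. [this file, g61] -/
theorem coherentWindowPsiBPGAt_nine_iff {ϑ₁ ω₁ ϑ aHi Λ θ s : ℝ} :
    CoherentWindowPsiBPGAt 9 ϑ₁ ω₁ ϑ aHi Λ θ s ↔ CoherentWindowPsiBPG₁ ϑ₁ ω₁ ϑ aHi Λ θ s := Iff.rfl

/-- antitone in the conclusion radius, monotone in the pair. [this file, g61] -/
theorem coherentWindowPsiBPGAt_anti {c c' ϑ₁ ϑ₁' ω₁ ω₁' ϑ aHi Λ θ s : ℝ} (hc : c' ≤ c) (hϑ : ϑ₁ ≤ ϑ₁') (hω : ω₁ ≤ ω₁')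
    (h : CoherentWindowPsiBPGAt c ϑ₁ ω₁ ϑ aHi Λ θ s) : CoherentWindowPsiBPGAt c' ϑ₁' ω₁' ϑ aHi Λ θ s := by
  intro δ hδ a ha Cg hCg K₀ hK₀
  obtain ⟨η₁, hη₁, R₁, hR₁, h1⟩ := h δ hδ a ha Cg hCg K₀ hK₀
  exact ⟨η₁, hη₁, R₁, hR₁, fun S hS hgood η hη hηle R hR L w hLw Ψ hΨ hBI hfat htame =>
    (h1 S hS hgood η hη hηle R hR L w hLw Ψ hΨ hBI hfat htame).mono hϑ hω (atomsIn_mono_mul hc (hR₁.le.trans hR))⟩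

/-- [W_Ψᵇ₁] ⇒ [W_Ψᵇ₁|c] for every `c ≤ 9` (PROVED). [this file, g61] -/
theorem coherentWindowPsiBPGAt_of_coherent₁ {c ϑ₁ ω₁ ϑ aHi Λ θ s : ℝ} (hc : c ≤ 9) (h : CoherentWindowPsiBPG₁ ϑ₁ ω₁ ϑ aHi Λ θ s) :
    CoherentWindowPsiBPGAt c ϑ₁ ω₁ ϑ aHi Λ θ s :=
  coherentWindowPsiBPGAt_anti hc le_rfl le_rfl (coherentWindowPsiBPGAt_nine_iff.2 h)

/-- ★★ **[ΨCoolᵇ] «PsiCoolWindowBPG ϑ₁ ϑ aHi Λ θ s» — TAME FAT NEAR-FLAT GSC DOOR WINDOWS ARE Ψ-COOL: THE MISFIT GAIN `ϑ → ϑ₁`, TILT-BLIND.**  With the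
binders of [W_Ψᵇ₁] verbatim (bond-isomorphic `(Cg, η, R)`-registered `Ψ` into an equilibrium `s`-chart, `K₀`-fat window, `ϑ`-tame on `win 9R`): every star
centred in `win 8R` is realised by `Ψ` within `ϑ₁` after a FREE proper rotation — `IsCoherentBy ϑ₁ 2 S Ψ (win 8R)` (tilt clause vacuous, `tilt_le_two`).  The
AMPLITUDE half of [W_Ψᵇ₁]: no WARM site (tame but not Ψ-cool) in `win 8R`; says nothing about orientation (a twisted tame grain IS Ψ-cool).  Factorises
kinematically as [NoWarmᵇ] ∧ [ΨRealᵇ] (YC-3, PROVED glue).  NEW · GSC-priced · NON-PERTURBATIVE (the warm band `[ϑ₁, ϑ)`: `1/20`-tame stars carry bond strains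
up to `≈ 5 %`, where the Lennard-Jones bond stiffness `V″ = 13r⁻¹⁴ − 7r⁻⁸` moves by `≈ 20 %` per `1 %` strain against the `≈ 15 %` relative coercivity margin of the
chart family (part TP docstring, census TAG 174 (a⁗) λ_rel ≥ 0.15) — the linearised operator at a warm state is NOT certified coercive, so no tree mechanism
([CC°_Ψᵇ], Gehring, the Campanato tower XM–XW: all start inside the coherent basin) reaches it) · UNDECIDED(stated test: census (F0c) «WarmScan» = the per-site
Kabsch-misfit histogram `m(x)` of the 54 relaxed interior windows of TAG 174 (a⁗) and of the generated θ-good defected windows of (F0b), read at `1/100` instead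
of `1/20`; prediction: `m < 1/100` on every interior site of a defect-free relaxed window) · INSTRUMENTABLE · WEAKER than [W_Ψᵇ₁] (`psiCoolWindowBPG_of_coherentAt`,
PROVED) · MECHANISM-NAMED for its SPARSE form [WSᵇ] (YC-5: the (M)-currency of parts TR/UI — higher integrability of the bond-isomorphic registration
strain, `#warm ≤ Σσ³/ϑ₁³`), IDEA-NEEDED for the pointwise upgrade (interior regularity at small strain with free rotations (F. John 1972) = ε-regularity OUTSIDE
the certified basin; size dichotomy as for [T]: FAT warm regions beyond the replacement scale by e⋆-GSC volume-vs-surface with a compactly supported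
competitor, SMALL isolated warm clusters in a cool collar by certified local rigidity, MESOSCOPIC warm lenses open).
Why it might fail: a mesoscopic (`10 ≲ r ≲ ϑ₁⁻²`), self-equilibrated, dislocation-free WARM LENS (strain `1–5 %`) coherently embedded in a cool matrix — tame,
single-site Nash, e⋆-GSC-compatible (surface-order excess) — which neither a finite certificate nor the GSC volume/surface comparison excludes; none is known
for Lennard-Jones close packings (an Eshelby inclusion needs an eigenstrain source, which chartedness forbids), none seen in the census at `1/20`.
Sources: part YB ([W_Ψᵇ₁]); part UC ([T], size dichotomy); part TP (stiffness vs margin); F. John, Comm. Pure Appl. Math. 25 (1972) 617 (uniqueness at small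
strain, free rotation); F. John, Comm. Pure Appl. Math. 14 (1961) 391 (rotation and strain); E–Ming, Arch. Ration. Mech. Anal. 183 (2007) 241;
Ehrlacher–Ortner–Shapeev, Arch. Ration. Mech. Anal. 222 (2016) 1217; CRITIC-LEDGER row 1160 (iii) (γ)+(α). [this file, g61] -/
def PsiCoolWindowBPG (ϑ₁ ϑ aHi Λ θ s : ℝ) : Prop :=
  ∀ δ : ℝ, 0 < δ → ∀ a : ℝ, 0 < a → ∀ Cg : ℝ, 1 ≤ Cg → ∀ K₀ : ℝ, 0 < K₀ → ∃ η₁ : ℝ, 0 < η₁ ∧ ∃ R₁ : ℝ, 0 < R₁ ∧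
    ∀ S : Set E3, IsDoorSetPG aHi δ S → (∀ q ∈ S, IsTwoShellAffineGood θ S q) →
      ∀ η : ℝ, 0 < η → η ≤ η₁ → ∀ R : ℝ, R₁ ≤ R →
        ∀ (L : E3 ≃L[ℝ] E3) (w : ℤ → E3), IsEquilChart a s Λ L w →
          ∀ Ψ : E3 → E3, IsGlobalReg Cg η R S (LayeredHom (L : E3 →L[ℝ] E3) w) Ψ → IsBondIso S Ψ →
            K₀ ≤ η * nK (atomsIn (μS S) 0 R) →
              IsTameOn ϑ S (LayeredHom (L : E3 →L[ℝ] E3) w) (atomsIn (μS S) 0 (9 * R)) →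
              IsCoherentBy ϑ₁ 2 S Ψ (atomsIn (μS S) 0 (8 * R))

/-- ★★ **[CoolLockedᵇ] «CoolLockedWindowBPG ϑ₁ ω₁ ϑ aHi Λ θ s» — Ψ-COOL TAME FAT NEAR-FLAT GSC DOOR WINDOWS ARE ORIENTATION-LOCKED.**  With the binders
of [W_Ψᵇ₁] verbatim plus the COOL hypothesis `IsCoherentBy ϑ₁ 2 S Ψ (win 8R)` (every star of `win 8R` realised by `Ψ` within `ϑ₁` after a free proper
rotation `M x`): on `win 7R` the realising rotation can be taken `ω₁`-close to the identity — `IsCoherentBy ϑ₁ ω₁ S Ψ (win 7R)` (same misfit: if the free best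
rotation has tilt `≤ ω₁` it is itself the witness).  The ORIENTATION half of [W_Ψᵇ₁], and the PERTURBATIVE one: inside the cool basin the rotation field
`x ↦ M x ∈ SO(3)` is `C·ϑ₁`-Lipschitz along bonds (overlapping stars share `≥ 4` non-coplanar atoms), carries the registration budget (`τ x ≥ c·tilt(M x) − ϑ₁`, so
`Σ_{win D} tilt² ≲ Cg·(D/R)·η·nK`), and the linearised operator at a rotated, `≤ ϑ₁/4`-strained chart is the rotated chart operator up to `O(ϑ₁)` relative
(frame indifference) — coercive by (U♮ᴱ) at the column's `ϑ₁ = 1/100`.  Mechanism (KNOWN-type, ATTACKABLE·L): EXCESS DECAY — ball-wise rigidity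
(Friesecke–James–Müller) to factor out the mean rotation on `B(x, r)`, harmonic approximation by the rotated chart operator, Campanato iteration of the excess
`E(x, r) := min_W ⨍_{B(x,r)} |∇u − W|²` from `r = R` (where `E ≤ 9Cg·η`) DOWN to `r = r₀`; the iteration only ever DEcreases the excess, so the smallness
hypothesis of each step is inherited, and `tilt(M x) ≤ |M̄_R − 1| + C·Σ_k E(x, θᵏR)^{1/2} ≤ C'·√(Cg·η) < ω₁` for `η ≤ η₁(ω₁)` (`|M̄_R − 1| ≲ √(Cg·η)` from the
position budget, as in part TR (K)).  The tree's Campanato tower (parts XM–XS) is the template, run for the rotation-factored excess instead of the budget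
density.  GSC-priced (the door) though the expected proof uses equilibrium + stability only · UNDECIDED · TRUE-type-expected · INSTRUMENTABLE ((F1)
«CoherenceScan» tilt column on cool windows) · WEAKER than [W_Ψᵇ₁] (`coolLockedWindowBPG_of_coherentAt`, PROVED).
Why it might fail: kinematics alone does NOT lock (F. John's logarithmic spiral `z ↦ z·|z|^{iε}`: strain `O(ε)` everywhere, rotation `ε·log|z|` unbounded —
sup-strain bounds rotation only in BMO, oscillation `≲ ϑ₁·log R` across the window), so the equilibrium equations must be used at every scale, with the
Lennard-Jones tail forces (range `∞`, handled as in (A2)/TailDominationCert) and the discrete harmonic approximation in rotated frames still to be typed; the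
perturbative margin at `ϑ₁ = 1/100` (affine strain `≤ 0.25 %`, stiffness change `≈ 5 %` < margin `15 %`) is adequate but not generous.
Sources: part YB ([W_Ψᵇ₁], twisted-grain violator); part TR ((K) `TiltRigidityP`, FJM 2002 Thm 3.1, Conti–Schweizer 2006); F. John, Comm. Pure Appl. Math. 14
(1961) 391; Giaquinta–Modica 1979 / [giaquinta1984 Ch. III] (Campanato iteration); Evans, Arch. Ration. Mech. Anal. 95 (1986) 227; parts XM–XS (tower);
part TP ((U♮ᴱ)); CRITIC-LEDGER row 1160 (iii) (β). [this file, g61] -/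
def CoolLockedWindowBPG (ϑ₁ ω₁ ϑ aHi Λ θ s : ℝ) : Prop :=
  ∀ δ : ℝ, 0 < δ → ∀ a : ℝ, 0 < a → ∀ Cg : ℝ, 1 ≤ Cg → ∀ K₀ : ℝ, 0 < K₀ → ∃ η₁ : ℝ, 0 < η₁ ∧ ∃ R₁ : ℝ, 0 < R₁ ∧
    ∀ S : Set E3, IsDoorSetPG aHi δ S → (∀ q ∈ S, IsTwoShellAffineGood θ S q) →
      ∀ η : ℝ, 0 < η → η ≤ η₁ → ∀ R : ℝ, R₁ ≤ R →
        ∀ (L : E3 ≃L[ℝ] E3) (w : ℤ → E3), IsEquilChart a s Λ L w →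
          ∀ Ψ : E3 → E3, IsGlobalReg Cg η R S (LayeredHom (L : E3 →L[ℝ] E3) w) Ψ → IsBondIso S Ψ →
            K₀ ≤ η * nK (atomsIn (μS S) 0 R) →
              IsTameOn ϑ S (LayeredHom (L : E3 →L[ℝ] E3) w) (atomsIn (μS S) 0 (9 * R)) →
              IsCoherentBy ϑ₁ 2 S Ψ (atomsIn (μS S) 0 (8 * R)) →
              IsCoherentBy ϑ₁ ω₁ S Ψ (atomsIn (μS S) 0 (7 * R))

/-- ★★ **GLUE (PROVED): [ΨCoolᵇ] ∧ [CoolLockedᵇ] ⇒ [W_Ψᵇ₁|7]** (`η₁ := min`, `R₁ := max`; the cool conclusion of the first feeds the second). [this file, g61] -/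
theorem coherentWindowPsiBPGAt_seven_of_cool_locked {ϑ₁ ω₁ ϑ aHi Λ θ s : ℝ} (hC : PsiCoolWindowBPG ϑ₁ ϑ aHi Λ θ s)
    (hL : CoolLockedWindowBPG ϑ₁ ω₁ ϑ aHi Λ θ s) : CoherentWindowPsiBPGAt 7 ϑ₁ ω₁ ϑ aHi Λ θ s := by
  intro δ hδ a ha Cg hCg K₀ hK₀
  obtain ⟨η₂, hη₂, R₂, hR₂, h2⟩ := hC δ hδ a ha Cg hCg K₀ hK₀
  obtain ⟨η₃, hη₃, R₃, hR₃, h3⟩ := hL δ hδ a ha Cg hCg K₀ hK₀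
  refine ⟨min η₂ η₃, lt_min hη₂ hη₃, max R₂ R₃, lt_max_of_lt_left hR₂, ?_⟩
  intro S hS hgood η hη hηle R hR L w hLw Ψ hΨ hBI hfat htame
  have hcool := h2 S hS hgood η hη (hηle.trans (min_le_left _ _)) R ((le_max_left _ _).trans hR) L w hLw Ψ hΨ hBI hfat htame
  exact h3 S hS hgood η hη (hηle.trans (min_le_right _ _)) R ((le_max_right _ _).trans hR) L w hLw Ψ hΨ hBI hfat htame hcool

/-- **[W_Ψᵇ₁|c] ⇒ [ΨCoolᵇ] for `c ≥ 8`, `ω₁ ≤ 2` (PROVED)** — the misfit-gain piece is WEAKER than the residual of record. [this file, g61] -/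
theorem psiCoolWindowBPG_of_coherentAt {c ϑ₁ ω₁ ϑ aHi Λ θ s : ℝ} (hc : 8 ≤ c) (hω : ω₁ ≤ 2) (h : CoherentWindowPsiBPGAt c ϑ₁ ω₁ ϑ aHi Λ θ s) :
    PsiCoolWindowBPG ϑ₁ ϑ aHi Λ θ s := by
  intro δ hδ a ha Cg hCg K₀ hK₀
  obtain ⟨η₁, hη₁, R₁, hR₁, h1⟩ := h δ hδ a ha Cg hCg K₀ hK₀
  exact ⟨η₁, hη₁, R₁, hR₁, fun S hS hgood η hη hηle R hR L w hLw Ψ hΨ hBI hfat htame =>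
    (h1 S hS hgood η hη hηle R hR L w hLw Ψ hΨ hBI hfat htame).mono le_rfl hω (atomsIn_mono_mul hc (hR₁.le.trans hR))⟩

/-- **[W_Ψᵇ₁|c] ⇒ [CoolLockedᵇ] for `c ≥ 7` (PROVED)** — the locking piece is WEAKER than the residual of record (it does not even use its cool hypothesis). [this file, g61] -/
theorem coolLockedWindowBPG_of_coherentAt {c ϑ₁ ω₁ ϑ aHi Λ θ s : ℝ} (hc : 7 ≤ c) (h : CoherentWindowPsiBPGAt c ϑ₁ ω₁ ϑ aHi Λ θ s) :
    CoolLockedWindowBPG ϑ₁ ω₁ ϑ aHi Λ θ s := by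
  intro δ hδ a ha Cg hCg K₀ hK₀
  obtain ⟨η₁, hη₁, R₁, hR₁, h1⟩ := h δ hδ a ha Cg hCg K₀ hK₀
  exact ⟨η₁, hη₁, R₁, hR₁, fun S hS hgood η hη hηle R hR L w hLw Ψ hΨ hBI hfat htame _ =>
    (h1 S hS hgood η hη hηle R hR L w hLw Ψ hΨ hBI hfat htame).mono le_rfl le_rfl (atomsIn_mono_mul hc (hR₁.le.trans hR))⟩

/-- the two pieces at the column literals are implied by the residual of record [W_Ψᵇ₁](1/100, 1/200) (PROVED). [this file, g61] -/
theorem psiCool_and_coolLocked_of_coherent₁ {ϑ aHi Λ θ s : ℝ} (h : CoherentWindowPsiBPG₁ (1 / 100) (1 / 200) ϑ aHi Λ θ s) :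
    PsiCoolWindowBPG (1 / 100) ϑ aHi Λ θ s ∧ CoolLockedWindowBPG (1 / 100) (1 / 200) ϑ aHi Λ θ s :=
  ⟨psiCoolWindowBPG_of_coherentAt (c := 8) (by norm_num) (by norm_num) (coherentWindowPsiBPGAt_of_coherent₁ (by norm_num) h),
    coolLockedWindowBPG_of_coherentAt (c := 7) (by norm_num) (coherentWindowPsiBPGAt_of_coherent₁ (by norm_num) h)⟩

end Summit.AtomisticToContinuum.Crystallization.Theorems.ChartedZeroExcessLayeredLatticeLiouville

end
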